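import Mathlib
import HarnessLib
import HarnessLib.Audit
import Summits.NavierStokesRegularity.Statement
import Literature.Analysis.FluidPDE.ClassicalSolution
import Literature.Analysis.FluidPDE.LerayHopf
import Literature.Analysis.FluidPDE.SelfSimilar
import Literature.Analysis.FluidPDE.SelfSimilarLiouville
import Literature.Analysis.FluidPDE.SuitableWeak
import Literature.Analysis.FluidPDE.NSWave0
import Summits.NavierStokesRegularity.NavierStokesRegularity.Theorems.AdiabaticEddyClayUniqueness
import HarnessLib.Audit.Status.Attr

/-!
Route: AncientHullSteering

# Route AncientHullSteering — every Type-I ancient profile truncates to finite-energy Type-I blow-up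
via hull steering

NEGATIVE side, forward rung (G1) above the proved floor
`DssFarFieldSlaving.DssTruncationBridgeTypeI`
(stmt-NavierStokesRegularity-14478, `Theorems.dssTruncationBridgeTypeI_proof`). It suffices, for
¬NavierStokesRegularity, to show
X = X1 ∧ X2: X1 (ANCIENT TRUNCATION BRIDGE, the rung = the floor with the
rotated-discrete-self-similarity hypothesis deleted): if SOME
nontrivial ancient mild solution (ν = 1) with measurable slices and Type-I space–time decay |u| ≤
C₀/(|x|+√(−t)) exists, then some
Leray–Hopf classical solution from a rapidly decaying datum has a finite maximal time with Type-I
rate; X2 (SELF-EXCITED TYPE-I PROFILE):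
such a profile exists in the bounded ancient class (verbatim the negation of
HubbleDynamo.NoSelfExcitedDynamo, stmt-NavierStokesRegularity-1934).
Lean:
`Summit.NavierStokesRegularity.NavierStokesRegularity.Theses.AncientHullSteering.AncientTruncationBridge
∧
Summit.NavierStokesRegularity.NavierStokesRegularity.Theses.AncientHullSteering.SelfExcitedTypeIProfile`

## Assembly
Pure logic plus Clay uniqueness (sorry-free `closes` in glue.lean, certified natively): assume
NavierStokesRegularity; X2 gives a
nontrivial bounded ancient Type-I-decaying profile; X1 turns it into a Leray–Hopf classical solution
from a rapidly decaying datum with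
finite maximal time T; Clay (A) gives a global smooth bounded-energy solution from the same datum,
which coincides with the blow-up
solution on [0,T) by `Theorems.adiabaticEddy_clayUniqueness_proof` (ESS weak–strong uniqueness,
in-tree) and so extends it past T —
contradicting maximality.

Rationale: WHY THIS LINE. The floor truncates a ROTATED-DSS Type-I profile by steering the compactly supported
correction onto the pseudo-stable set of ONE
period map of the c-adic renormalisation (Riesz–Schauder gap + Lyapunov–Perron:
`Theorems.PseudoStableSteering`, `Theorems.RdssProfileTruncation`).
For an ARBITRARY Type-I-decaying ancient profile the slab maps are a NONAUTONOMOUS cocycle S + K(σ^k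
ξ) over the compact HULL Ω of the
profile's rescaling orbit (σ = rescale by c); a uniform dichotomy is false in general (Sacker–Sell
intervals), but multiplicative ergodic
theory for semi-invertible quasi-compact Banach cocycles (GonzalezTokmanQuas2014 Thm 2.10,
FroylandLloydQuas2013, LianLu2010) gives a
TEMPERED splitting with finitely many exponents above the essential rate at μ-a.e. hull point, and
only ONE profile is needed, so
genericity is free; tempered Lyapunov–Perron steering (LianLu2010) then replaces the Floquet gap,
and the blow-down of AlbrittonBarker2019
(Thm 1.1, Prop 2.3) supplies concentration. Imported: smooth ergodic theory in Banach spaces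
(Oseledets/Pesin) into the blow-up
truncation problem; the discrete-RG-plus-stable-manifold shape is BricmontKupiainen1994's, made
nonautonomous. No prior route or negatives
entry states truncation for the general Type-I class; Tao2011 (Thm 20) localises only finite-energy
categories.

RANKED CRUXES. #2 AncientTruncationBridge (crux) — the rung: existence of one nontrivial ancient
mild solution (ν = 1, measurable slices) with Type-I space–time decay |u(x,t)| ≤ C₀/(|x|+√(−t))
implies a Type-I blow-up of a Leray–Hopf classical solution from a rapidly decaying datum (the floor
stmt-14478 with `IsRotatedDSS` removed). [difficulty: XL] (why it might fail: without
self-similarity the slab maps are a nonautonomous cocycle on the hull: Sacker–Sell spectrum may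
leave no uniform gap, and the tempered Oseledets gap at a generic hull point may be eaten by the
nonlinearity when corrections must stay compactly supported.) [AlbrittonBarker2019,
GonzalezTokmanQuas2014, FroylandLloydQuas2013, LianLu2010, BricmontKupiainen1994, Tao2011,
ChaeWolf2017RemovingDSS]
#3 SelfExcitedTypeIProfile (crux) — there is a nontrivial bounded ancient mild solution (ν = 1,
measurable slices) with Type-I space–time decay |u| ≤ C/(|x|+√(−t)) — verbatim
¬HubbleDynamo.NoSelfExcitedDynamo; strictly weaker than the parent's open crux BlowupTypeIDssProfile
(stmt-0155), which asks the profile to be rotated-DSS. [difficulty: open-problem] (why it might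
fail: KNSS 2009 / Seregin–Šverák (L) conjecture NO nontrivial bounded ancient mild solution exists;
HubbleDynamo staffs exactly the negation (stmt-1934); exactly self-similar (Tsai1998), near-one DSS
(ChaeWolf2017RemovingDSS) and axisymmetric (SereginSverak2009) witnesses are already excluded.)
[KochNadirashviliSereginSverak2009, SereginSverak2009, AlbrittonBarker2019, Tsai1998,
NecasRuzickaSverak1996, ChaeWolf2017RemovingDSS]

TWO-LAYER PLAN. Foreseen split of AncientTruncationBridge once staffed (k = 3, depth 1, = the
registered birth skeleton): BlowdownConcentration
(AB blow-down of the profile concentrates at the origin) → HullCocyclePackage ∧ GenericDichotomy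
(slab maps = θ-contraction + compact,
continuous over the compact hull; semi-invertible Oseledets ⇒ tempered dichotomy at a generic hull
point) → TemperedSteering (tempered
Lyapunov–Perron with dense compactly supported corrections) → AncientTruncationBridge
(`AncientTruncationBridge_of`, kernel-checked).

KILL CRITERIA. A proof of HubbleDynamo.NoSelfExcitedDynamo (stmt-NavierStokesRegularity-1934) — i.e.
the KNSS Liouville conjecture in the Type-I-decay
class — refutes SelfExcitedTypeIProfile: close `refuted:SelfExcitedTypeIProfile` (the designed
dichotomy with the positive route
HubbleDynamo; either way the summit learns). A counterexample to AncientTruncationBridge (a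
nontrivial Type-I ancient profile all of whose
compactly supported truncations stay regular through t = 0) refutes the rung and pins blow-up
truncation to self-similar structure:
close `refuted:AncientTruncationBridge`, bank the RDSS floor. If BlowupTypeIDssProfile (stmt-0155)
is PROVED, the parent route already
gives ¬NS and this route is superseded (`--reason superseded --by
route-NavierStokesRegularity-DssFarFieldSlaving`).

NOT DECOMPOSED YET. The four stubs of the birth skeleton (blow-down concentration; hull cocycle
package with its function space E, dense subspace D and
slab semantics; generic tempered dichotomy; tempered steering) stay layer-2 until a prover takes the
crux; the choice c = 2 of rescaling
ratio, the invariant measure on the hull (Krylov–Bogolyubov + ergodic decomposition) and the Kato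
smallness constants are prover-side.

CHEAPEST FALSIFIER. For the LINE: an explicit contraction-plus-compact cocycle S + K(σ^k ξ) on ℓ²
over a minimal homeomorphism σ with NO tempered gap below
multiplier 1 at ANY hull point would kill stub GenericDichotomy — impossible by
GonzalezTokmanQuas2014 Thm 2.10 (exceptional exponents are
isolated, of finite multiplicity, accumulating only at κ* ≤ log θ < 0), checked against the printed
statement (paper:arxiv-1105.5609 p. 9).
For the ROUTE: the literature lookup "is the KNSS conjecture proved in the class |u| ≤
C/(|x|+√(−t))?" — no (AlbrittonBarker2019 §1;
ChaeWolf2017RemovingDSS only for λ-DSS with λ near 1); run weekly against lit frontier.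

NUMBERS. Floor: rotated λ-DSS profiles, any λ = c > 1, any rotation R (stmt-14478, proved). Known
exclusions inside X2's witness set: λ-DSS with
1 < λ < λ₁(C₀) (ChaeWolf2017RemovingDSS Thm 1.3); backward self-similar with profile in L^q, 3 < q ≤
∞ (Tsai1998 Thm 1,
NecasRuzickaSverak1996 Thm 1); axisymmetric Type-I (SereginSverak2009 Thm 1.1). Items at open: 2.

DEFINITION REQUESTS. None: IsAncientMildSolution, IsBoundedAncientMildSolution, HasTypeIDecay,
IsMaximalSmoothSolution, IsLerayHopfOn, HasRapidSpatialDecay,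
IsTypeIBlowup all exist in Literature.Analysis.FluidPDE.

Novelty: Searches (2026-08-17): lit search "semi-invertible Oseledets theorem Banach space" (10 local MET
papers, 13 remote; GonzalezTokmanQuas2014 held as paper:arxiv-1105.5609); lit search --hybrid "Lian
Lu invariant manifolds random dynamical systems Banach space" (8 books: duan2014, mierczynski2008
…); lit search "invariant manifolds random dynamical systems Banach space Lian Lu memoirs" (8 local
citing papers, zbMATH doi:10.1090/s0065-9266-10-00574-0); lit vsearch "truncate an infinite-energy
self-similar or singular Navier-Stokes profile to a finite-energy solution that still blows up …
stable manifold of the renormalisation map" (10 irrelevant book hits); lit search --hybrid "Bricmont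
Kupiainen renormalization group blow-up nonlinear heat" (no relevant hit); lit read arxiv:1811.00502
--grep truncat (p. 3, p. 6), arxiv:1108.1165 --grep equivalent (Thm 20), arxiv:0709.3599 --grep
conjecture (p. 3); lit galaxy search "Oseledets|multiplicative ergodic" --star pdf (1 relevant:
pdf:-1445908165988055460 Gouëzel–Karlsson), "Bricmont|Kupiainen" --star pdf (8 noise), "mild bounded
ancient|Type I singularit|discretely self-similar" and "bounded ancient solution|Type I singularity"
--star pdf (galaxyd saturated, queued > 90 s, twice); ledger negatives --problem
NavierStokesRegularity (5, none on truncation); lean exact? dedup over Mathlib + 366 FluidPDE/Theses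
modules (no hit for either crux).
Nearest prior art found: the floor itself (stmt-NavierStokesRegularity-14478, rotated-DSS case, i  [refs: 10.1090/s0065-9266-10-00574-0, 1811.00502, 1108.1165, 0709.3599, paper:arxiv-1105.5609, doi:10.1090/s0065-9266-10-00574-0, arxiv:1811.00502, arxiv:1108.1165, arxiv:0709.3599, paper:arxiv-0709.3599, paper:arxiv-1811.00502, GonzalezTokmanQuas2014, AlbrittonBarker2019, Tao2011, BricmontKupiainen1994, LianLu2010, KochNadirashviliSereginSverak2009]

Barriers (technique_class: blowup-truncation hull-cocycle oseledets blow-down): - technique_class: blowup-truncation, type-I-ancient-profile, blow-down,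
discrete-renormalisation-hull, semi-invertible-oseledets, lyapunov-perron-pseudo-stable-manifold
- Literature.Barriers.NavierStokesRegularity.LeraySelfSimilarBlowupExclusion: quantifies over
EXACTLY backward self-similar profiles (NRS 1996 / Tsai 1998); AncientTruncationBridge is an
implication over all Type-I-decaying profiles and never posits self-similarity;
SelfExcitedTypeIProfile's witness must therefore be non-self-similar (a bounded self-similar profile
lies in L^q, q > 3, hence vanishes) — allowed by its typing, which carries no symmetry.
- Literature.Barriers.NavierStokesRegularity.NearOneDssTypeIExclusion: kills λ-DSS Type-I profiles
with 1 < λ < λ₁(C₀) only (Chae–Wolf 2017 Thm 1.3); the rung's own rescaling ratio c = 2 is a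
bookkeeping choice on an arbitrary profile, not a DSS hypothesis, and X2's witness may be coarse-DSS
or non-DSS.
- Literature.Barriers.NavierStokesRegularity.AxisymmetricTypeIExclusion: excludes axisymmetric
Type-I witnesses of X2 (Seregin–Šverák 2009); X2 carries no symmetry and the floor's rotated-DSS
profiles are generically non-axisymmetric.
- Literature.Barriers.NavierStokesRegularity.CriticalNormBlowupNecessity: consistent — the blow-up
produced by X1 is pointwise Type-I, so ‖u(t)‖_{L³} → ∞ is allowed (and forced); the line never keeps
a critical norm bounded.
- Literature.Barriers.NavierStokesRegularity.SingularSetDimensionBound: consistent — one space–time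
singular

sub-problem: NavierStokesRegularity · status: draft · opened planner-fwd-rung-NavierStokesRegularity-03-0 2026-08-17T19:18:21Z · rev 0 · ledger route-NavierStokesRegularity-AncientHullSteering
GENERATED by the gate from the ledger (D-0016/17). Provers cite these decls: `theorem foo : Summit.NavierStokesRegularity.NavierStokesRegularity.Theses.AncientHullSteering.<Decl> := …` in Summits/NavierStokesRegularity/NavierStokesRegularity/Theorems/<Name>.lean.
-/

namespace Summit.NavierStokesRegularity.NavierStokesRegularity.Theses.AncientHullSteering

open scoped BigOperators Topology Manifold Classical MeasureTheory ProbabilityTheory Matrix InnerProductSpace ComplexConjugate ContinuousMap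
open Filter Set Function TopologicalSpace MeasureTheory

attribute [summit_statement] _root_.NavierStokesRegularity

open Literature.NS

/-- item stmt-NavierStokesRegularity-20185 · crux · rank 2 · open · by planner
why it might fail: without self-similarity the slab maps are a nonautonomous cocycle on the hull: Sacker–Sell spectrum may leave no uniform gap, and the tempered Oseledets gap at a generic hull point may be eaten by the nonlinearity when corrections must stay compactly supported.
sources: AlbrittonBarker2019, GonzalezTokmanQuas2014, FroylandLloydQuas2013, LianLu2010, BricmontKupiainen1994, Tao2011
[crux] the rung: existence of one nontrivial ancient mild solution (ν = 1, measurable slices) with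
Type-I space–time decay |u(x,t)| ≤ C₀/(|x|+√(−t)) implies a Type-I blow-up of a Leray–Hopf classical
solution from a rapidly decaying datum (the floor stmt-14478 with `IsRotatedDSS` removed).
[difficulty: XL] -/
@[route_item "route-NavierStokesRegularity-AncientHullSteering", crux]
def AncientTruncationBridge : Prop :=
  (∃ u : ℝ → EuclideanSpace ℝ (Fin 3) → EuclideanSpace ℝ (Fin 3), Literature.Analysis.FluidPDE.IsAncientMildSolution 1 u ∧ (∀ t < 0, MeasureTheory.AEStronglyMeasurable (u t) MeasureTheory.volume) ∧ (∃ C₀ : ℝ, Literature.Analysis.FluidPDE.HasTypeIDecay C₀ u) ∧ ¬ (∀ t < 0, u t =ᵐ[MeasureTheory.volume] 0)) → ∃ ν : ℝ, 0 < ν ∧ ∃ T : ℝ, 0 < T ∧ ∃ (u : ℝ → EuclideanSpace ℝ (Fin 3) → EuclideanSpace ℝ (Fin 3)) (p : ℝ → EuclideanSpace ℝ (Fin 3) → ℝ), Literature.Analysis.FluidPDE.IsMaximalSmoothSolution ν 0 u p T ∧ Literature.Analysis.FluidPDE.IsLerayHopfOn T ν 0 (u 0) u ∧ Literature.Analysis.FluidPDE.HasRapidSpatialDecay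 (u 0) ∧ Literature.Analysis.FluidPDE.IsTypeIBlowup u T

/-- item stmt-NavierStokesRegularity-20186 · crux · rank 3 · open · by planner
why it might fail: KNSS 2009 / Seregin–Šverák (L) conjecture NO nontrivial bounded ancient mild solution exists; HubbleDynamo staffs exactly the negation (stmt-1934); exactly self-similar (Tsai1998), near-one DSS (ChaeWolf2017RemovingDSS) and axisymmetric (SereginSverak2009) witnesses are already excluded.
sources: KochNadirashviliSereginSverak2009, SereginSverak2009, AlbrittonBarker2019, Tsai1998, NecasRuzickaSverak1996, ChaeWolf2017RemovingDSS
[crux] there is a nontrivial bounded ancient mild solution (ν = 1, measurable slices) with Type-I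
space–time decay |u| ≤ C/(|x|+√(−t)) — verbatim ¬HubbleDynamo.NoSelfExcitedDynamo; strictly weaker
than the parent's open crux BlowupTypeIDssProfile (stmt-0155), which asks the profile to be
rotated-DSS. [difficulty: open-problem] -/
@[route_item "route-NavierStokesRegularity-AncientHullSteering", crux]
def SelfExcitedTypeIProfile : Prop :=
  ¬ (∀ u : ℝ → EuclideanSpace ℝ (Fin 3) → EuclideanSpace ℝ (Fin 3), Literature.Analysis.FluidPDE.IsBoundedAncientMildSolution 1 u → (∀ t < 0, MeasureTheory.AEStronglyMeasurable (u t) MeasureTheory.volume) → (∃ C : ℝ, Literature.Analysis.FluidPDE.HasTypeIDecay C u) → ∀ t < 0, u t =ᵐ[MeasureTheory.volume] 0)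

/-- item stmt-NavierStokesRegularity-20187 · assembly · rank 1 · closed · proved by Summit.NavierStokesRegularity.NavierStokesRegularity.Theorems.ancientHullSteering_assembly_proof (prover) · by planner
sources: FeffermanClay2006, EscauriazaSereginSverak2003, AlbrittonBarker2019
[assembly] AncientTruncationBridge → SelfExcitedTypeIProfile → ¬NavierStokesRegularity (the deciding
theorem `closes` of glue.lean proves exactly this). -/
@[route_item "route-NavierStokesRegularity-AncientHullSteering"]
def Assembly : Prop :=
  AncientTruncationBridge → SelfExcitedTypeIProfile → ¬ _root_.NavierStokesRegularity

-- `Assembly` holds: proved by `Summit.NavierStokesRegularity.NavierStokesRegularity.Theorems.ancientHullSteering_assembly_proof` (its module imports this route file, so no `_holds` link can be stated here).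

/-! D-0027 §2.1 — DECIDING THEOREM (planner-authored via `route open/edit --closes-file`; by planner-fwd-rung-NavierStokesRegularity-03-0 2026-08-17T19:18:21Z):
its hypotheses are this route's items and its conclusion the sub-problem Statement (glue_lint), and it elaborates with this file. -/

@[closes "route-NavierStokesRegularity-AncientHullSteering"] theorem closes (hR : AncientTruncationBridge) (hP : SelfExcitedTypeIProfile) :
    ¬ _root_.NavierStokesRegularity := by
  intro hA
  apply hP
  intro w hw hmeas hwdec
  by_contra hnt
  obtain ⟨ν, hν, T, hT, u, p, ⟨hcl, hmax⟩, hLH, hdec, -⟩ :=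
    hR ⟨w, hw.isAncientMildSolution, hmeas, hwdec, hnt⟩
  have hU := _root_.Summit.NavierStokesRegularity.NavierStokesRegularity.Theorems.adiabaticEddy_clayUniqueness_proof
  have h0 : (0 : ℝ) ∈ Set.Ico 0 T := ⟨le_rfl, hT⟩
  obtain ⟨u', p', hu', hp', hns, hbe⟩ :=
    hA ν hν (u 0) (hcl.contDiff_velocity h0) (hcl.divFree 0 h0) hdec
  have heq : ∀ t ∈ Set.Ico 0 T, u' t = u t :=
    hU ν hν (u 0) hdec u' u p' p T hT hu' hp' hns hbe hcl hLH rfl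
  have hcl' : Literature.Analysis.FluidPDE.IsClassicalNSSolutionOn (Set.Ici 0) ν 0 u' p' :=
    ⟨hu', hp', fun t ht x => hns.momentum t ht x, fun t ht => hns.divFree t ht⟩
  refine hmax ⟨T + 1, by linarith, u', p', ?_, heq⟩
  exact hcl'.mono (fun t ht => ht.1) (uniqueDiffOn_Ico 0 (T + 1))

end Summit.NavierStokesRegularity.NavierStokesRegularity.Theses.AncientHullSteering
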